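import Mathlib
import Summits.Ventures.PercRepro2.TypedThreeState

/-!
# The two-copy and three-copy transfer identities (blind cell PercRepro2, mine-2 g38, 2026-08-28;
`proofs/MINE2-GADGET.md` §3′, row M2-79)

`TypedThreeState.lean` attaches `o` (resp. `b`) to a root in ONE of three copies at a time and sums
the three symmetrised kernel values.  Here the same for TWO copies at a time (the three pairs) and
for all three at once: with `x, y, w` any three states in which `o` is attached to neither root,

  `KBsym x⁺ y⁺ w + KBsym x⁺ y w⁺ + KBsym x y⁺ w⁺ = 0`   and   `KBsym x⁺ y⁺ w⁺ = 0`

(`KBsym_two_o_L / _H`, `KBsym_all_o_L / _H`, and the `b`-versions).  Together with the one-copy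
identities (and the trivial case in which no copy attaches) these are the four Bernstein
coefficients of a pendant mark: a bundle of edges from `o` (or `b`) to one root, of any types,
contributes nothing to the typed count — the state-level content of the `o`-separation theorem for
`N(o) ⊆ {a₁}` / `N(o) ⊆ {a₂}` (`code/merge_k.py`: 729 / 729 triples for every `k = 0 … 3`, both
marks, both roots).

Each theorem is decided on its 4,096 `Q`-state triples and extended by `KBsym_eq_zero_of_q'`.
Own code; standard axioms.
-/

namespace Summit.Ventures.PercRepro2

open UnionCluster

namespace CovForm

namespace ThreeState

open OneTyped Untouched

/-! ## Two copies at a time -/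

/-- The `o → a₁` two-copy identity on `Q`-states (4,096 cases). -/
theorem KBsym_two_o_L_Q (Lb₁ Hb₁ L3₁ H3₁ Lb₂ Hb₂ L3₂ H3₂ Lb₃ Hb₃ L3₃ H3₃ : Bool) :
    KBsym (stOL false Lb₁ Hb₁ L3₁ H3₁) (stOL false Lb₂ Hb₂ L3₂ H3₂) (stO0 false Lb₃ Hb₃ L3₃ H3₃) +
      KBsym (stOL false Lb₁ Hb₁ L3₁ H3₁) (stO0 false Lb₂ Hb₂ L3₂ H3₂) (stOL false Lb₃ Hb₃ L3₃ H3₃) +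
      KBsym (stO0 false Lb₁ Hb₁ L3₁ H3₁) (stOL false Lb₂ Hb₂ L3₂ H3₂) (stOL false Lb₃ Hb₃ L3₃ H3₃) =
      0 := by
  revert Lb₁ Hb₁ L3₁ H3₁ Lb₂ Hb₂ L3₂ H3₂ Lb₃ Hb₃ L3₃ H3₃
  decide +kernel

/-- The `o → a₂` two-copy identity on `Q`-states (4,096 cases). -/
theorem KBsym_two_o_H_Q (Lb₁ Hb₁ L3₁ H3₁ Lb₂ Hb₂ L3₂ H3₂ Lb₃ Hb₃ L3₃ H3₃ : Bool) :
    KBsym (stOH false Lb₁ Hb₁ L3₁ H3₁) (stOH false Lb₂ Hb₂ L3₂ H3₂) (stO0 false Lb₃ Hb₃ L3₃ H3₃) +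
      KBsym (stOH false Lb₁ Hb₁ L3₁ H3₁) (stO0 false Lb₂ Hb₂ L3₂ H3₂) (stOH false Lb₃ Hb₃ L3₃ H3₃) +
      KBsym (stO0 false Lb₁ Hb₁ L3₁ H3₁) (stOH false Lb₂ Hb₂ L3₂ H3₂) (stOH false Lb₃ Hb₃ L3₃ H3₃) =
      0 := by
  revert Lb₁ Hb₁ L3₁ H3₁ Lb₂ Hb₂ L3₂ H3₂ Lb₃ Hb₃ L3₃ H3₃
  decide +kernel

/-- The `b → a₁` two-copy identity on `Q`-states (4,096 cases). -/
theorem KBsym_two_b_L_Q (Lo₁ Ho₁ L3₁ H3₁ Lo₂ Ho₂ L3₂ H3₂ Lo₃ Ho₃ L3₃ H3₃ : Bool) :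
    KBsym (stBL false Lo₁ Ho₁ L3₁ H3₁) (stBL false Lo₂ Ho₂ L3₂ H3₂) (stB0 false Lo₃ Ho₃ L3₃ H3₃) +
      KBsym (stBL false Lo₁ Ho₁ L3₁ H3₁) (stB0 false Lo₂ Ho₂ L3₂ H3₂) (stBL false Lo₃ Ho₃ L3₃ H3₃) +
      KBsym (stB0 false Lo₁ Ho₁ L3₁ H3₁) (stBL false Lo₂ Ho₂ L3₂ H3₂) (stBL false Lo₃ Ho₃ L3₃ H3₃) =
      0 := by
  revert Lo₁ Ho₁ L3₁ H3₁ Lo₂ Ho₂ L3₂ H3₂ Lo₃ Ho₃ L3₃ H3₃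
  decide +kernel

/-- The `b → a₂` two-copy identity on `Q`-states (4,096 cases). -/
theorem KBsym_two_b_H_Q (Lo₁ Ho₁ L3₁ H3₁ Lo₂ Ho₂ L3₂ H3₂ Lo₃ Ho₃ L3₃ H3₃ : Bool) :
    KBsym (stBH false Lo₁ Ho₁ L3₁ H3₁) (stBH false Lo₂ Ho₂ L3₂ H3₂) (stB0 false Lo₃ Ho₃ L3₃ H3₃) +
      KBsym (stBH false Lo₁ Ho₁ L3₁ H3₁) (stB0 false Lo₂ Ho₂ L3₂ H3₂) (stBH false Lo₃ Ho₃ L3₃ H3₃) +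
      KBsym (stB0 false Lo₁ Ho₁ L3₁ H3₁) (stBH false Lo₂ Ho₂ L3₂ H3₂) (stBH false Lo₃ Ho₃ L3₃ H3₃) =
      0 := by
  revert Lo₁ Ho₁ L3₁ H3₁ Lo₂ Ho₂ L3₂ H3₂ Lo₃ Ho₃ L3₃ H3₃
  decide +kernel

/-! ## All three copies -/

/-- With `o ∈ C(a₁)` in all three copies the symmetrised kernel vanishes (4,096 cases). -/
theorem KBsym_all_o_L_Q (Lb₁ Hb₁ L3₁ H3₁ Lb₂ Hb₂ L3₂ H3₂ Lb₃ Hb₃ L3₃ H3₃ : Bool) :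
    KBsym (stOL false Lb₁ Hb₁ L3₁ H3₁) (stOL false Lb₂ Hb₂ L3₂ H3₂) (stOL false Lb₃ Hb₃ L3₃ H3₃) =
      0 := by
  revert Lb₁ Hb₁ L3₁ H3₁ Lb₂ Hb₂ L3₂ H3₂ Lb₃ Hb₃ L3₃ H3₃
  decide +kernel

/-- With `o ∈ C(a₂)` in all three copies the symmetrised kernel vanishes (4,096 cases). -/
theorem KBsym_all_o_H_Q (Lb₁ Hb₁ L3₁ H3₁ Lb₂ Hb₂ L3₂ H3₂ Lb₃ Hb₃ L3₃ H3₃ : Bool) :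
    KBsym (stOH false Lb₁ Hb₁ L3₁ H3₁) (stOH false Lb₂ Hb₂ L3₂ H3₂) (stOH false Lb₃ Hb₃ L3₃ H3₃) =
      0 := by
  revert Lb₁ Hb₁ L3₁ H3₁ Lb₂ Hb₂ L3₂ H3₂ Lb₃ Hb₃ L3₃ H3₃
  decide +kernel

/-- With `b ∈ C(a₁)` in all three copies the symmetrised kernel vanishes (4,096 cases). -/
theorem KBsym_all_b_L_Q (Lo₁ Ho₁ L3₁ H3₁ Lo₂ Ho₂ L3₂ H3₂ Lo₃ Ho₃ L3₃ H3₃ : Bool) :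
    KBsym (stBL false Lo₁ Ho₁ L3₁ H3₁) (stBL false Lo₂ Ho₂ L3₂ H3₂) (stBL false Lo₃ Ho₃ L3₃ H3₃) =
      0 := by
  revert Lo₁ Ho₁ L3₁ H3₁ Lo₂ Ho₂ L3₂ H3₂ Lo₃ Ho₃ L3₃ H3₃
  decide +kernel

/-- With `b ∈ C(a₂)` in all three copies the symmetrised kernel vanishes (4,096 cases). -/
theorem KBsym_all_b_H_Q (Lo₁ Ho₁ L3₁ H3₁ Lo₂ Ho₂ L3₂ H3₂ Lo₃ Ho₃ L3₃ H3₃ : Bool) :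
    KBsym (stBH false Lo₁ Ho₁ L3₁ H3₁) (stBH false Lo₂ Ho₂ L3₂ H3₂) (stBH false Lo₃ Ho₃ L3₃ H3₃) =
      0 := by
  revert Lo₁ Ho₁ L3₁ H3₁ Lo₂ Ho₂ L3₂ H3₂ Lo₃ Ho₃ L3₃ H3₃
  decide +kernel

/-- With `o` attached to neither root in all three copies the symmetrised kernel vanishes
(`F = 0` and `PD · 1_{o∈U} = 0` everywhere; 4,096 cases). -/
theorem KBsym_none_o_Q (Lb₁ Hb₁ L3₁ H3₁ Lb₂ Hb₂ L3₂ H3₂ Lb₃ Hb₃ L3₃ H3₃ : Bool) :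
    KBsym (stO0 false Lb₁ Hb₁ L3₁ H3₁) (stO0 false Lb₂ Hb₂ L3₂ H3₂) (stO0 false Lb₃ Hb₃ L3₃ H3₃) =
      0 := by
  revert Lb₁ Hb₁ L3₁ H3₁ Lb₂ Hb₂ L3₂ H3₂ Lb₃ Hb₃ L3₃ H3₃
  decide +kernel

/-- With `b` attached to neither root in all three copies the symmetrised kernel vanishes
(4,096 cases). -/
theorem KBsym_none_b_Q (Lo₁ Ho₁ L3₁ H3₁ Lo₂ Ho₂ L3₂ H3₂ Lo₃ Ho₃ L3₃ H3₃ : Bool) :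
    KBsym (stB0 false Lo₁ Ho₁ L3₁ H3₁) (stB0 false Lo₂ Ho₂ L3₂ H3₂) (stB0 false Lo₃ Ho₃ L3₃ H3₃) =
      0 := by
  revert Lo₁ Ho₁ L3₁ H3₁ Lo₂ Ho₂ L3₂ H3₂ Lo₃ Ho₃ L3₃ H3₃
  decide +kernel

/-! ## The general statements (any `q′`) -/

/-- **The `o → a₁` two-copy identity.** -/
theorem KBsym_two_o_L (q₁ q₂ q₃ Lb₁ Hb₁ L3₁ H3₁ Lb₂ Hb₂ L3₂ H3₂ Lb₃ Hb₃ L3₃ H3₃ : Bool) :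
    KBsym (stOL q₁ Lb₁ Hb₁ L3₁ H3₁) (stOL q₂ Lb₂ Hb₂ L3₂ H3₂) (stO0 q₃ Lb₃ Hb₃ L3₃ H3₃) +
      KBsym (stOL q₁ Lb₁ Hb₁ L3₁ H3₁) (stO0 q₂ Lb₂ Hb₂ L3₂ H3₂) (stOL q₃ Lb₃ Hb₃ L3₃ H3₃) +
      KBsym (stO0 q₁ Lb₁ Hb₁ L3₁ H3₁) (stOL q₂ Lb₂ Hb₂ L3₂ H3₂) (stOL q₃ Lb₃ Hb₃ L3₃ H3₃) = 0 := by
  cases q₁ <;> cases q₂ <;> cases q₃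
  · exact KBsym_two_o_L_Q Lb₁ Hb₁ L3₁ H3₁ Lb₂ Hb₂ L3₂ H3₂ Lb₃ Hb₃ L3₃ H3₃
  all_goals
    rw [KBsym_eq_zero_of_q' _ _ _ (by simp [stO0, stOL, St.q']),
      KBsym_eq_zero_of_q' _ _ _ (by simp [stO0, stOL, St.q']),
      KBsym_eq_zero_of_q' _ _ _ (by simp [stO0, stOL, St.q'])]
    ring

/-- **The `o → a₂` two-copy identity.** -/
theorem KBsym_two_o_H (q₁ q₂ q₃ Lb₁ Hb₁ L3₁ H3₁ Lb₂ Hb₂ L3₂ H3₂ Lb₃ Hb₃ L3₃ H3₃ : Bool) :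
    KBsym (stOH q₁ Lb₁ Hb₁ L3₁ H3₁) (stOH q₂ Lb₂ Hb₂ L3₂ H3₂) (stO0 q₃ Lb₃ Hb₃ L3₃ H3₃) +
      KBsym (stOH q₁ Lb₁ Hb₁ L3₁ H3₁) (stO0 q₂ Lb₂ Hb₂ L3₂ H3₂) (stOH q₃ Lb₃ Hb₃ L3₃ H3₃) +
      KBsym (stO0 q₁ Lb₁ Hb₁ L3₁ H3₁) (stOH q₂ Lb₂ Hb₂ L3₂ H3₂) (stOH q₃ Lb₃ Hb₃ L3₃ H3₃) = 0 := by
  cases q₁ <;> cases q₂ <;> cases q₃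
  · exact KBsym_two_o_H_Q Lb₁ Hb₁ L3₁ H3₁ Lb₂ Hb₂ L3₂ H3₂ Lb₃ Hb₃ L3₃ H3₃
  all_goals
    rw [KBsym_eq_zero_of_q' _ _ _ (by simp [stO0, stOH, St.q']),
      KBsym_eq_zero_of_q' _ _ _ (by simp [stO0, stOH, St.q']),
      KBsym_eq_zero_of_q' _ _ _ (by simp [stO0, stOH, St.q'])]
    ring

/-- **The `b → a₁` two-copy identity.** -/
theorem KBsym_two_b_L (q₁ q₂ q₃ Lo₁ Ho₁ L3₁ H3₁ Lo₂ Ho₂ L3₂ H3₂ Lo₃ Ho₃ L3₃ H3₃ : Bool) :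
    KBsym (stBL q₁ Lo₁ Ho₁ L3₁ H3₁) (stBL q₂ Lo₂ Ho₂ L3₂ H3₂) (stB0 q₃ Lo₃ Ho₃ L3₃ H3₃) +
      KBsym (stBL q₁ Lo₁ Ho₁ L3₁ H3₁) (stB0 q₂ Lo₂ Ho₂ L3₂ H3₂) (stBL q₃ Lo₃ Ho₃ L3₃ H3₃) +
      KBsym (stB0 q₁ Lo₁ Ho₁ L3₁ H3₁) (stBL q₂ Lo₂ Ho₂ L3₂ H3₂) (stBL q₃ Lo₃ Ho₃ L3₃ H3₃) = 0 := by
  cases q₁ <;> cases q₂ <;> cases q₃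
  · exact KBsym_two_b_L_Q Lo₁ Ho₁ L3₁ H3₁ Lo₂ Ho₂ L3₂ H3₂ Lo₃ Ho₃ L3₃ H3₃
  all_goals
    rw [KBsym_eq_zero_of_q' _ _ _ (by simp [stB0, stBL, St.q']),
      KBsym_eq_zero_of_q' _ _ _ (by simp [stB0, stBL, St.q']),
      KBsym_eq_zero_of_q' _ _ _ (by simp [stB0, stBL, St.q'])]
    ring

/-- **The `b → a₂` two-copy identity.** -/
theorem KBsym_two_b_H (q₁ q₂ q₃ Lo₁ Ho₁ L3₁ H3₁ Lo₂ Ho₂ L3₂ H3₂ Lo₃ Ho₃ L3₃ H3₃ : Bool) :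
    KBsym (stBH q₁ Lo₁ Ho₁ L3₁ H3₁) (stBH q₂ Lo₂ Ho₂ L3₂ H3₂) (stB0 q₃ Lo₃ Ho₃ L3₃ H3₃) +
      KBsym (stBH q₁ Lo₁ Ho₁ L3₁ H3₁) (stB0 q₂ Lo₂ Ho₂ L3₂ H3₂) (stBH q₃ Lo₃ Ho₃ L3₃ H3₃) +
      KBsym (stB0 q₁ Lo₁ Ho₁ L3₁ H3₁) (stBH q₂ Lo₂ Ho₂ L3₂ H3₂) (stBH q₃ Lo₃ Ho₃ L3₃ H3₃) = 0 := by
  cases q₁ <;> cases q₂ <;> cases q₃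
  · exact KBsym_two_b_H_Q Lo₁ Ho₁ L3₁ H3₁ Lo₂ Ho₂ L3₂ H3₂ Lo₃ Ho₃ L3₃ H3₃
  all_goals
    rw [KBsym_eq_zero_of_q' _ _ _ (by simp [stB0, stBH, St.q']),
      KBsym_eq_zero_of_q' _ _ _ (by simp [stB0, stBH, St.q']),
      KBsym_eq_zero_of_q' _ _ _ (by simp [stB0, stBH, St.q'])]
    ring

/-- **`o` on the `a₁` side in all three copies**: the symmetrised kernel vanishes. -/
theorem KBsym_all_o_L (q₁ q₂ q₃ Lb₁ Hb₁ L3₁ H3₁ Lb₂ Hb₂ L3₂ H3₂ Lb₃ Hb₃ L3₃ H3₃ : Bool) :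
    KBsym (stOL q₁ Lb₁ Hb₁ L3₁ H3₁) (stOL q₂ Lb₂ Hb₂ L3₂ H3₂) (stOL q₃ Lb₃ Hb₃ L3₃ H3₃) = 0 := by
  cases q₁ <;> cases q₂ <;> cases q₃
  · exact KBsym_all_o_L_Q Lb₁ Hb₁ L3₁ H3₁ Lb₂ Hb₂ L3₂ H3₂ Lb₃ Hb₃ L3₃ H3₃
  all_goals exact KBsym_eq_zero_of_q' _ _ _ (by simp [stOL, St.q'])

/-- **`o` on the `a₂` side in all three copies**: the symmetrised kernel vanishes. -/
theorem KBsym_all_o_H (q₁ q₂ q₃ Lb₁ Hb₁ L3₁ H3₁ Lb₂ Hb₂ L3₂ H3₂ Lb₃ Hb₃ L3₃ H3₃ : Bool) :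
    KBsym (stOH q₁ Lb₁ Hb₁ L3₁ H3₁) (stOH q₂ Lb₂ Hb₂ L3₂ H3₂) (stOH q₃ Lb₃ Hb₃ L3₃ H3₃) = 0 := by
  cases q₁ <;> cases q₂ <;> cases q₃
  · exact KBsym_all_o_H_Q Lb₁ Hb₁ L3₁ H3₁ Lb₂ Hb₂ L3₂ H3₂ Lb₃ Hb₃ L3₃ H3₃
  all_goals exact KBsym_eq_zero_of_q' _ _ _ (by simp [stOH, St.q'])

/-- **`b` on the `a₁` side in all three copies**: the symmetrised kernel vanishes. -/
theorem KBsym_all_b_L (q₁ q₂ q₃ Lo₁ Ho₁ L3₁ H3₁ Lo₂ Ho₂ L3₂ H3₂ Lo₃ Ho₃ L3₃ H3₃ : Bool) :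
    KBsym (stBL q₁ Lo₁ Ho₁ L3₁ H3₁) (stBL q₂ Lo₂ Ho₂ L3₂ H3₂) (stBL q₃ Lo₃ Ho₃ L3₃ H3₃) = 0 := by
  cases q₁ <;> cases q₂ <;> cases q₃
  · exact KBsym_all_b_L_Q Lo₁ Ho₁ L3₁ H3₁ Lo₂ Ho₂ L3₂ H3₂ Lo₃ Ho₃ L3₃ H3₃
  all_goals exact KBsym_eq_zero_of_q' _ _ _ (by simp [stBL, St.q'])

/-- **`b` on the `a₂` side in all three copies**: the symmetrised kernel vanishes. -/
theorem KBsym_all_b_H (q₁ q₂ q₃ Lo₁ Ho₁ L3₁ H3₁ Lo₂ Ho₂ L3₂ H3₂ Lo₃ Ho₃ L3₃ H3₃ : Bool) :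
    KBsym (stBH q₁ Lo₁ Ho₁ L3₁ H3₁) (stBH q₂ Lo₂ Ho₂ L3₂ H3₂) (stBH q₃ Lo₃ Ho₃ L3₃ H3₃) = 0 := by
  cases q₁ <;> cases q₂ <;> cases q₃
  · exact KBsym_all_b_H_Q Lo₁ Ho₁ L3₁ H3₁ Lo₂ Ho₂ L3₂ H3₂ Lo₃ Ho₃ L3₃ H3₃
  all_goals exact KBsym_eq_zero_of_q' _ _ _ (by simp [stBH, St.q'])

/-- **`o` attached to neither root in all three copies**: the symmetrised kernel vanishes. -/
theorem KBsym_none_o (q₁ q₂ q₃ Lb₁ Hb₁ L3₁ H3₁ Lb₂ Hb₂ L3₂ H3₂ Lb₃ Hb₃ L3₃ H3₃ : Bool) :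
    KBsym (stO0 q₁ Lb₁ Hb₁ L3₁ H3₁) (stO0 q₂ Lb₂ Hb₂ L3₂ H3₂) (stO0 q₃ Lb₃ Hb₃ L3₃ H3₃) = 0 := by
  cases q₁ <;> cases q₂ <;> cases q₃
  · exact KBsym_none_o_Q Lb₁ Hb₁ L3₁ H3₁ Lb₂ Hb₂ L3₂ H3₂ Lb₃ Hb₃ L3₃ H3₃
  all_goals exact KBsym_eq_zero_of_q' _ _ _ (by simp [stO0, St.q'])

/-- **`b` attached to neither root in all three copies**: the symmetrised kernel vanishes. -/
theorem KBsym_none_b (q₁ q₂ q₃ Lo₁ Ho₁ L3₁ H3₁ Lo₂ Ho₂ L3₂ H3₂ Lo₃ Ho₃ L3₃ H3₃ : Bool) :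
    KBsym (stB0 q₁ Lo₁ Ho₁ L3₁ H3₁) (stB0 q₂ Lo₂ Ho₂ L3₂ H3₂) (stB0 q₃ Lo₃ Ho₃ L3₃ H3₃) = 0 := by
  cases q₁ <;> cases q₂ <;> cases q₃
  · exact KBsym_none_b_Q Lo₁ Ho₁ L3₁ H3₁ Lo₂ Ho₂ L3₂ H3₂ Lo₃ Ho₃ L3₃ H3₃
  all_goals exact KBsym_eq_zero_of_q' _ _ _ (by simp [stB0, St.q'])

end ThreeState

end CovForm

end Summit.Ventures.PercRepro2
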